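import Mathlib.MeasureTheory.Constructions.BorelSpace.Basic
import Mathlib.MeasureTheory.Integral.Bochner.Set
import Mathlib.Analysis.Normed.Module.Connected
import Mathlib.Analysis.SpecialFunctions.Complex.Log
import Mathlib.Analysis.SpecialFunctions.Pow.Real
import Mathlib.Analysis.SpecialFunctions.Log.Basic
import Literature.NumberTheory.Automorphic.TateLocalFactors
import Literature.NumberTheory.Automorphic.LocalLanglandsGLProofs
import Literature.NumberTheory.Automorphic.GodementJacquetLocal
import Literature.NumberTheory.Automorphic.JacquetModuleProofs
import Literature.NumberTheory.GaloisRepresentations.LocalFieldProofs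
import HarnessLib

/-!
# Tate's local theory: exponents of quasi-characters, a test function, uniqueness of `γ` (proved)

Companion to `TateLocalFactors` (Tate 1950, §2.3–2.4; Bushnell–Henniart 2006, §23). That file
states the local functional equation of Tate's thesis as the PREDICATE
`HasTateGamma ψ μ μ' χ γ` (`Z(f̂, χ⁻¹, 1 - s) = γ(q^{-s}) Z(f, χ, s)` for every exponent `σ` of
`χ`, every Schwartz–Bruhat `f` and every `s` in the strip `-σ < re s < 1 - σ`) and records
"every quasi-character has a unique real exponent" as the named fact
`QuasiChar.existsUnique_hasExponent` (Tate 1950, §2.3, Lemma 2.3.1). Everything below is PROVED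
(Mathlib + the tree):

* `Units.borelSpace` (a theorem, used via `haveI`): for a topological group with zero with continuous inversion off `0`
  (e.g. a topological field) carrying its Borel structure, Mathlib's measurable structure on the
  unit group (`Units.instMeasurableSpace`, the pull-back along `Units.val`) is the Borel
  structure of the unit-group topology (`Units.isEmbedding_val₀`, `borel_comap`). So Haar
  measures on `Fˣ` (`[BorelSpace F]`) see open sets.
* `isCompact_units_valuation_eq_one`, `isOpen_units_valuation_eq_one`: the unit group
  `𝒪ˣ = {v = 1}` is compact open in `Fˣ` (from the unit sphere of `F`,
  `DeltaCharBorel.isCompact_setOf_valuation_eq_one` etc. of `JacquetModuleProofs`, along the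
  embedding `Units.val`).
* `QuasiChar.norm_eq_one_of_valuation_eq_one`: `|χ(u)| = 1` on `𝒪ˣ` for every quasi-character
  `χ` (a continuous homomorphism from the compact group `𝒪ˣ` to `ℝ_{>0}` is bounded, hence
  trivial).
* `QuasiChar.exists_hasExponent`, `QuasiChar.HasExponent.unique`,
  `QuasiChar.existsUnique_hasExponent_holds` (**discharge** of the named fact): with a uniformiser
  `ϖ` and `σ = -log |χ(ϖ)| / log q` one has `|χ(x)| = |x|_F^σ` (write `x = u ϖ^k`, `u ∈ 𝒪ˣ`,
  `|ϖ|_F = q⁻¹` by `normAbs_uniformizer_holds`); uniqueness from `|ϖ|_F^σ = |ϖ|_F^{σ'}`, `q > 1`.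
  (Tate 1950, §2.3, Lemma 2.3.1; Bushnell–Henniart 2006, §1.5.)
* `exists_schwartzBruhat_tateZeta_eq_const`: for a Haar measure `μ'` on `Fˣ` and any `χ` there
  is a Schwartz–Bruhat `f` on `F` — the characteristic function of an open subgroup
  `H ≤ ker χ ∩ 𝒪ˣ` (`exists_isOpen_subgroup_units_subset`, `isOpen_ker_quasiChar_holds` of
  `LocalLanglandsGLProofs`) — with `Z(f, χ, s) = μ'(H) > 0` for ALL `s`: on `H` the integrand
  `f χ |·|^s` is `1`. (Tate 1950, §2.4–2.5, the computation of `ζ(f, c)` on `1 + 𝔭^n`;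
  Bushnell–Henniart 2006, §23.5.)
* `ratFunc_eq_of_evalAtQ_eq_on_strip`: a rational function of `T = q^{-s}` is determined by its
  values for `s` in any vertical strip (the circle `|T| = q^{-c}` minus the poles is infinite;
  `ratFunc_eq_of_eval_eq_on_infinite` of `GodementJacquetLocal`).
* `HasTateGamma.unique`, `HasTateGamma.existsUnique_of_exists`: **Tate's `γ`-factor is unique**
  — for `[BorelSpace F]` and `μ'` Haar on `Fˣ`, and for ANY `ψ`, `μ`:
  `HasTateGamma ψ μ μ' χ γ → HasTateGamma ψ μ μ' χ γ' → γ = γ'`; so the named fact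
  `existsUnique_hasTateGamma` reduces to existence (Tate 1950, Thm. 2.4.1).

* `QuasiChar.IsUnramified.apply_mk0_eq`, `tateEulerFactor_of_isUnramified_holds`,
  `QuasiChar.hasConductorExp_zero_iff_holds`: **discharges** of the named facts
  `tateEulerFactor_of_isUnramified` (`P_χ = 1 - χ(ϖ) T` for every uniformiser `ϖ`; Tate 1950,
  §2.4) and `QuasiChar.hasConductorExp_zero_iff` (conductor exponent `0` iff unramified; Tate
  1950, §2.3).

Theorems only: no definitions, no instances, no named facts (D-0026). Used by
`RankinSelbergLocalTateCompatible` (compatibility of `γ(s, π × χ, ψ)` with Tate's factors).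

## References

* J. Tate, *Fourier analysis in number fields and Hecke's zeta-functions* (thesis, 1950), in
  Cassels–Fröhlich, *Algebraic Number Theory* (1967), §2.3 (Lemma 2.3.1), §2.4 (Thm. 2.4.1),
  §2.5. [Tate1950]
* C. J. Bushnell, G. Henniart, *The local Langlands conjecture for `GL(2)`*, Springer 2006,
  §1.5, §23.4–23.5. [BushnellHenniart2006]
-/

set_option autoImplicit false

open scoped NNReal Topology
open MeasureTheory ValuativeRel Topology
  Literature.NumberTheory.GaloisRepresentations.IsNonarchimedeanLocalField

noncomputable section

namespace Literature.NumberTheory.Automorphic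

/-! ### The Borel structure of the unit group -/

section UnitsBorel

/-- For a topological group with zero `G₀` whose inversion is continuous off `0` (e.g. a
topological field) and which carries its Borel structure, Mathlib's measurable structure on
`G₀ˣ` (`Units.instMeasurableSpace`, the pull-back of that of `G₀` along `Units.val`) is the Borel
structure of the unit-group topology: `Units.val` is a topological embedding
(`Units.isEmbedding_val₀`) and `borel` commutes with induced topologies (`borel_comap`).
A `theorem` (Prop-valued class), to be invoked as `haveI : BorelSpace Fˣ := Units.borelSpace`.
[folklore] -/
theorem Units.borelSpace {G₀ : Type*} [GroupWithZero G₀] [TopologicalSpace G₀]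
    [ContinuousInv₀ G₀] [MeasurableSpace G₀] [BorelSpace G₀] : BorelSpace G₀ˣ := by
  refine ⟨?_⟩
  rw [Units.isEmbedding_val₀.eq_induced, borel_comap, ← BorelSpace.measurable_eq (α := G₀)]
  rfl

end UnitsBorel

/-! ### The unit sphere and the norm of a quasi-character -/

section UnitSphere

variable {F : Type*} [Field F] [ValuativeRel F] [TopologicalSpace F] [IsNonarchimedeanLocalField F]

/-- The unit group `𝒪ˣ = {u ∈ Fˣ | v(u) = 1}` is compact in `Fˣ` (`Units.val` is an embedding
with image of `𝒪ˣ` the unit sphere). [folklore] -/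
theorem isCompact_units_valuation_eq_one : IsCompact {u : Fˣ | valuation F (u : F) = 1} := by
  rw [Units.isEmbedding_val₀.isCompact_iff]
  have h : ((↑) : Fˣ → F) '' {u : Fˣ | valuation F (u : F) = 1} =
      {x : F | valuation F x = 1} := by
    ext x
    constructor
    · rintro ⟨u, hu, rfl⟩
      exact hu
    · intro hx
      have hx0 : x ≠ 0 := by
        rintro rfl
        simp at hx
      exact ⟨Units.mk0 x hx0, hx, rfl⟩
  rw [h]
  exact DeltaCharBorel.isCompact_setOf_valuation_eq_one F

/-- The unit group `𝒪ˣ` is open in `Fˣ`. [folklore] -/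
theorem isOpen_units_valuation_eq_one : IsOpen {u : Fˣ | valuation F (u : F) = 1} :=
  (DeltaCharBorel.isOpen_setOf_valuation_eq one_ne_zero).preimage Units.continuous_val

/-- **`|χ(u)| = 1` on the unit group** for every quasi-character `χ : Fˣ → ℂˣ`: the continuous
homomorphism `u ↦ |χ(u)|` is bounded on the compact group `𝒪ˣ`, and a bounded subgroup of
`ℝ_{>0}` is trivial (Tate 1950, §2.3, proof of Lemma 2.3.1: "`c` is trivial on the compact
`𝔲`"; Bushnell–Henniart 2006, §1.5). [cite: Tate1950, §2.3] -/
theorem QuasiChar.norm_eq_one_of_valuation_eq_one (χ : QuasiChar F) {u : Fˣ}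
    (hu : valuation F (u : F) = 1) : ‖((χ u : ℂˣ) : ℂ)‖ = 1 := by
  set K : Set Fˣ := {u : Fˣ | valuation F (u : F) = 1} with hK
  have hKc : IsCompact K := isCompact_units_valuation_eq_one
  have hcont : Continuous fun w : Fˣ => ‖((χ w : ℂˣ) : ℂ)‖ :=
    (Units.continuous_val.comp (map_continuous χ)).norm
  obtain ⟨M, hM⟩ := hKc.exists_bound_of_continuousOn hcont.continuousOn
  have hpow : ∀ w : Fˣ, w ∈ K → ∀ n : ℕ, w ^ n ∈ K := fun w hw n => by
    simp only [hK, Set.mem_setOf_eq, Units.val_pow_eq_pow_val, map_pow] at hw ⊢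
    rw [hw, one_pow]
  have hle : ∀ w ∈ K, ‖((χ w : ℂˣ) : ℂ)‖ ≤ 1 := by
    intro w hw
    by_contra h
    push Not at h
    obtain ⟨n, hn⟩ := pow_unbounded_of_one_lt M h
    have h1 := hM (w ^ n) (hpow w hw n)
    rw [Real.norm_of_nonneg (norm_nonneg _), map_pow, Units.val_pow_eq_pow_val, norm_pow] at h1
    exact absurd (hn.trans_le h1) (lt_irrefl M)
  have hinvK : u⁻¹ ∈ K := by
    simp only [hK, Set.mem_setOf_eq, Units.val_inv_eq_inv_val, map_inv₀, hu, inv_one]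
  refine le_antisymm (hle u hu) ?_
  have h2 := hle u⁻¹ hinvK
  rw [map_inv, Units.val_inv_eq_inv_val, norm_inv] at h2
  have hpos : 0 < ‖((χ u : ℂˣ) : ℂ)‖ := norm_pos_iff.mpr (χ u).ne_zero
  exact (inv_le_one₀ hpos).mp h2

/-- Every unit has valuation `v(ϖ)^k` for some `k ∈ ℤ` (the value group of a non-archimedean
local field is infinite cyclic, generated by the value of a uniformiser; Serre, *Local Fields*,
Ch. II §1). [folklore] -/
theorem exists_valuation_eq_zpow_of_isUniformizer {ϖ : F} (hϖ : (valuation F).IsUniformizer ϖ)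
    (x : Fˣ) : ∃ k : ℤ, valuation F (x : F) = valuation F ϖ ^ k := by
  have h0 : valuation F (x : F) ≠ 0 := by simp
  have hmem : Units.mk0 _ h0 ∈
      MonoidWithZeroHom.valueGroup (MonoidWithZeroHom.ofClass (valuation F)) := by
    rw [valueGroup_valuation_eq_top]
    exact Subgroup.mem_top _
  rw [← Valuation.IsRankOneDiscrete.generator_zpowers_eq_valueGroup] at hmem
  obtain ⟨k, hk⟩ := Subgroup.mem_zpowers_iff.mp hmem
  refine ⟨k, ?_⟩
  have h := congrArg Units.val hk
  rw [Units.val_zpow_eq_zpow_val, Units.val_mk0] at h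
  rw [← h, hϖ.val]

/-- Real-exponent bookkeeping: if `q^{-σ} = t₀` then `(q^{-k})^σ = t₀^k` (`k ∈ ℤ`). [folklore] -/
private lemma zpow_rpow_eq_of_rpow_neg_eq {q t₀ σ : ℝ} (hq0 : 0 < q) (hqσ : q ^ (-σ) = t₀)
    (k : ℤ) : (q ^ (-k)) ^ σ = t₀ ^ k := by
  rw [← hqσ, ← Real.rpow_intCast q (-k), ← Real.rpow_mul hq0.le, ← Real.rpow_intCast _ k,
    ← Real.rpow_mul hq0.le]
  congr 1
  push_cast
  ring

/-- **Every quasi-character has a real exponent** (Tate 1950, §2.3, Lemma 2.3.1: `|χ| = |·|^σ`;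
Bushnell–Henniart 2006, §1.5): with a uniformiser `ϖ` and `σ = -log |χ(ϖ)| / log q`, writing
`x = u ϖ^k` with `u ∈ 𝒪ˣ` gives `|χ(x)| = |χ(ϖ)|^k = q^{-kσ} = |x|_F^σ`
(`QuasiChar.norm_eq_one_of_valuation_eq_one`, `|ϖ|_F = q⁻¹` by `normAbs_uniformizer_holds`).
[cite: Tate1950, §2.3, Lemma 2.3.1] -/
theorem QuasiChar.exists_hasExponent (χ : QuasiChar F) : ∃ σ : ℝ, χ.HasExponent σ := by
  obtain ⟨ϖ₀, hϖ₀⟩ := Valuation.exists_isUniformizer_of_isCyclic_of_nontrivial (valuation F)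
  set ϖ : Fˣ := Units.mk0 (ϖ₀ : F) hϖ₀.ne_zero with hϖdef
  have hϖ : (valuation F).IsUniformizer (ϖ : F) := hϖ₀
  have hvϖ : valuation F (ϖ : F) ≠ 0 := by simp
  set q : ℝ := (residueFieldCard F : ℝ) with hqdef
  have hq : 1 < q := by
    rw [hqdef]
    exact_mod_cast one_lt_residueFieldCard F
  have hq0 : 0 < q := zero_lt_one.trans hq
  set t₀ : ℝ := ‖((χ ϖ : ℂˣ) : ℂ)‖ with ht₀def
  have ht₀ : 0 < t₀ := norm_pos_iff.mpr (χ ϖ).ne_zero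
  set σ : ℝ := -Real.log t₀ / Real.log q with hσdef
  have hlogq : Real.log q ≠ 0 := Real.log_ne_zero_of_pos_of_ne_one hq0 hq.ne'
  have hqσ : q ^ (-σ) = t₀ := by
    have hmul : Real.log q * (Real.log t₀ / Real.log q) = Real.log t₀ := by
      field_simp
    rw [hσdef, neg_div, neg_neg, Real.rpow_def_of_pos hq0, hmul, Real.exp_log ht₀]
  refine ⟨σ, fun x => ?_⟩
  obtain ⟨k, hk⟩ := exists_valuation_eq_zpow_of_isUniformizer hϖ x
  -- `u = x ϖ^{-k} ∈ 𝒪ˣ`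
  have hu : valuation F ((x * ϖ ^ (-k) : Fˣ) : F) = 1 := by
    rw [Units.val_mul, Units.val_zpow_eq_zpow_val, map_mul, map_zpow₀, hk, ← zpow_add₀ hvϖ,
      add_neg_cancel, zpow_zero]
  have hxeq : x = (x * ϖ ^ (-k)) * ϖ ^ k := by
    rw [mul_assoc, ← zpow_add, neg_add_cancel, zpow_zero, mul_one]
  -- `|χ(x)| = t₀^k`
  have hnorm : ‖((χ x : ℂˣ) : ℂ)‖ = t₀ ^ k := by
    conv_lhs => rw [hxeq]
    rw [map_mul, map_zpow, Units.val_mul, Units.val_zpow_eq_zpow_val, norm_mul, norm_zpow,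
      χ.norm_eq_one_of_valuation_eq_one hu, one_mul]
  -- `|x|_F = q^{-k}`
  have habs : ((normAbs F (x : F) : ℝ≥0) : ℝ) = q ^ (-k) := by
    conv_lhs => rw [hxeq]
    rw [Units.val_mul, Units.val_zpow_eq_zpow_val, map_mul, map_zpow₀,
      DeltaCharBorel.normAbs_eq_one_of_valuation_eq_one hu, one_mul, normAbs_uniformizer_holds hϖ,
      NNReal.coe_zpow, NNReal.coe_inv, NNReal.coe_natCast, inv_zpow, ← zpow_neg]
  rw [hnorm, habs, zpow_rpow_eq_of_rpow_neg_eq hq0 hqσ k]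

/-- The exponent of a quasi-character is unique: `|ϖ|_F^σ = |ϖ|_F^{σ'}` with `|ϖ|_F = q⁻¹ ≠ 1`
forces `σ = σ'` (Tate 1950, §2.3, Lemma 2.3.1). [cite: Tate1950, §2.3, Lemma 2.3.1] -/
theorem QuasiChar.HasExponent.unique {χ : QuasiChar F} {σ σ' : ℝ} (h : χ.HasExponent σ)
    (h' : χ.HasExponent σ') : σ = σ' := by
  obtain ⟨ϖ₀, hϖ⟩ := Valuation.exists_isUniformizer_of_isCyclic_of_nontrivial (valuation F)
  have hq : (1 : ℝ) < residueFieldCard F := by exact_mod_cast one_lt_residueFieldCard F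
  have key := (h (Units.mk0 (ϖ₀ : F) hϖ.ne_zero)).symm.trans (h' (Units.mk0 (ϖ₀ : F) hϖ.ne_zero))
  rw [Units.val_mk0, normAbs_uniformizer_holds hϖ, NNReal.coe_inv, NNReal.coe_natCast] at key
  have hb0 : (0 : ℝ) < ((residueFieldCard F : ℝ))⁻¹ := inv_pos.mpr (zero_lt_one.trans hq)
  have hb1 : ((residueFieldCard F : ℝ))⁻¹ ≠ 1 := by
    rw [Ne, inv_eq_one]
    exact hq.ne'
  have hlog := congrArg Real.log key
  rw [Real.log_rpow hb0, Real.log_rpow hb0] at hlog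
  exact mul_right_cancel₀ (Real.log_ne_zero_of_pos_of_ne_one hb0 hb1) hlog

/-- **Discharge of the named fact `QuasiChar.existsUnique_hasExponent`** (`TateLocalFactors`;
Tate 1950, §2.3, Lemma 2.3.1): every quasi-character of `Fˣ` has a unique real exponent.
[cite: Tate1950, §2.3, Lemma 2.3.1] -/
theorem QuasiChar.existsUnique_hasExponent_holds :
    QuasiChar.existsUnique_hasExponent (F := F) := fun χ => by
  obtain ⟨σ, hσ⟩ := χ.exists_hasExponent
  exact ⟨σ, hσ, fun σ' hσ' => hσ'.unique hσ⟩

end UnitSphere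

/-! ### A test function with constant non-zero zeta integral -/

section TestFunction

variable {F : Type*} [Field F] [ValuativeRel F] [TopologicalSpace F] [IsNonarchimedeanLocalField F]
  [MeasurableSpace F] [BorelSpace F]

/-- **A Schwartz–Bruhat function whose zeta integral is a non-zero constant** (Tate 1950,
§2.4–2.5: `ζ(f, c)` for `f` the characteristic function of `1 + 𝔭^n`, `n ≥` the conductor;
Bushnell–Henniart 2006, §23.5). For a Haar measure `μ'` on `Fˣ` and any quasi-character `χ`
there are an open subgroup `H ≤ ker χ ∩ 𝒪ˣ` of `Fˣ` (congruence subgroups are a basis,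
`exists_isOpen_subgroup_units_subset`; `ker χ` is open, `isOpen_ker_quasiChar_holds`) and
`f = 1_H ∈ 𝒮(F)` (its image in `F` is compact open) with `Z(f, χ, s) = μ'(H) > 0` for every
`s ∈ ℂ`: on `H` one has `f = 1`, `χ = 1`, `|·|_F = 1`. [cite: Tate1950, §2.5] -/
theorem exists_schwartzBruhat_tateZeta_eq_const (μ' : Measure Fˣ) [μ'.IsHaarMeasure]
    (χ : QuasiChar F) :
    ∃ f ∈ SchwartzBruhat F, ∃ c : ℝ, 0 < c ∧ ∀ s : ℂ, tateZeta μ' f χ s = (c : ℂ) := by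
  haveI : T2Space F := (GaloisRepresentations.IsNonarchimedeanLocalField.isLocalField F).toT2Space
  haveI : BorelSpace Fˣ := Units.borelSpace
  -- `K = 𝒪ˣ`, `V = ker χ ∩ K`, an open subgroup `H ⊆ V`
  set K : Set Fˣ := {u : Fˣ | valuation F (u : F) = 1} with hKdef
  have hKo : IsOpen K := isOpen_units_valuation_eq_one
  have hKc : IsCompact K := isCompact_units_valuation_eq_one
  have hker : IsOpen (((χ : Fˣ →* ℂˣ).ker : Set Fˣ)) := isOpen_ker_quasiChar_holds χ
  have hV : ((χ : Fˣ →* ℂˣ).ker : Set Fˣ) ∩ K ∈ 𝓝 (1 : Fˣ) :=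
    (hker.inter hKo).mem_nhds ⟨by simp, by simp [hKdef]⟩
  obtain ⟨H, hHo, hHV⟩ := exists_isOpen_subgroup_units_subset hV
  have hHK : (H : Set Fˣ) ⊆ K := fun u hu => (hHV hu).2
  have hHker : ∀ u ∈ H, χ u = 1 := fun u hu => by
    have h1 := (hHV hu).1
    rw [SetLike.mem_coe, MonoidHom.mem_ker] at h1
    exact h1
  have hHc : IsCompact (H : Set Fˣ) :=
    hKc.of_isClosed_subset (Subgroup.isClosed_of_isOpen H hHo) hHK
  -- the compact open image `T ⊆ F`
  set T : Set F := ((↑) : Fˣ → F) '' (H : Set Fˣ) with hTdef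
  have hrange : Set.range ((↑) : Fˣ → F) = {0}ᶜ := by
    ext x
    simp only [Set.mem_range, Set.mem_compl_iff, Set.mem_singleton_iff]
    constructor
    · rintro ⟨u, rfl⟩
      exact u.ne_zero
    · intro hx
      exact ⟨Units.mk0 x hx, rfl⟩
  have hemb : IsOpenEmbedding ((↑) : Fˣ → F) :=
    ⟨Units.isEmbedding_val₀, by rw [hrange]; exact isOpen_compl_singleton⟩
  have hTo : IsOpen T := hemb.isOpenMap _ hHo
  have hTc : IsCompact T := hHc.image Units.continuous_val
  have hTcl : IsClosed T := hTc.isClosed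
  refine ⟨T.indicator 1, ?_, μ'.real (H : Set Fˣ), ?_, ?_⟩
  · rw [mem_schwartzBruhat_iff]
    refine ⟨?_, HasCompactSupport.intro' hTc hTcl fun x hx => Set.indicator_of_notMem hx _⟩
    rw [IsLocallyConstant.iff_exists_open]
    intro x
    by_cases hx : x ∈ T
    · exact ⟨T, hTo, hx, fun x' hx' => by
        rw [Set.indicator_of_mem hx', Set.indicator_of_mem hx]
        rfl⟩
    · exact ⟨Tᶜ, hTcl.isOpen_compl, hx, fun x' hx' => by
        rw [Set.indicator_of_notMem hx', Set.indicator_of_notMem hx]⟩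
  · exact ENNReal.toReal_pos (hHo.measure_pos μ' ⟨1, H.one_mem⟩).ne' hHc.measure_lt_top.ne
  · intro s
    have hint : ∀ x : Fˣ, T.indicator (1 : F → ℂ) (x : F) * ((χ x : ℂˣ) : ℂ) *
        (((normAbs F (x : F) : ℝ≥0) : ℝ) : ℂ) ^ s = (H : Set Fˣ).indicator (fun _ => (1 : ℂ)) x := by
      intro x
      by_cases hx : x ∈ (H : Set Fˣ)
      · have hxT : (x : F) ∈ T := Set.mem_image_of_mem _ hx
        have hx1 : valuation F (x : F) = 1 := hHK hx
        rw [Set.indicator_of_mem hxT, Set.indicator_of_mem hx, hHker x hx,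
          DeltaCharBorel.normAbs_eq_one_of_valuation_eq_one hx1]
        simp
      · have hxT : (x : F) ∉ T := fun h => hx (Units.val_injective.mem_set_image.mp h)
        rw [Set.indicator_of_notMem hxT, Set.indicator_of_notMem hx]
        simp
    have hHm : MeasurableSet (H : Set Fˣ) := hHo.measurableSet
    rw [tateZeta, integral_congr_ae (Filter.Eventually.of_forall hint),
      integral_indicator_const _ hHm, Complex.real_smul, mul_one]

end TestFunction

/-! ### Rational functions of `q^{-s}` on a vertical strip; uniqueness of Tate's `γ` -/

section Uniqueness

/-- **A rational function of `T = q^{-s}` is determined by its values on a vertical strip**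
`a < re s < b` (`1 < q`): the points `q^{-s}`, `re s = (a+b)/2`, fill the circle
`|T| = q^{-(a+b)/2}`, which stays infinite after removing the poles of both functions
(`ratFunc_eq_of_eval_eq_on_infinite`). [folklore] -/
theorem ratFunc_eq_of_evalAtQ_eq_on_strip {q : ℕ} (hq : 1 < q) {a b : ℝ} (hab : a < b)
    {R R' : RatFunc ℂ}
    (h : ∀ s : ℂ, a < s.re → s.re < b → evalAtQ q R s = evalAtQ q R' s) : R = R' := by
  set c : ℝ := (a + b) / 2 with hc
  have hqpos : (0 : ℝ) < q := by exact_mod_cast (zero_lt_one.trans hq)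
  have hq1 : (1 : ℝ) < q := by exact_mod_cast hq
  set r : ℝ := (q : ℝ) ^ (-c) with hr
  have hr0 : 0 < r := Real.rpow_pos_of_pos hqpos _
  set P : Set ℂ := {t | R.denom.IsRoot t} ∪ {t | R'.denom.IsRoot t} with hP
  have hPfin : P.Finite :=
    (Polynomial.finite_setOf_isRoot (RatFunc.denom_ne_zero R)).union
      (Polynomial.finite_setOf_isRoot (RatFunc.denom_ne_zero R'))
  set S : Set ℂ := Metric.sphere (0 : ℂ) r \ P with hS
  have hSinf : S.Infinite := by
    have hsph : (Metric.sphere (0 : ℂ) r).Infinite := by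
      refine (isPreconnected_sphere ?_ (0 : ℂ) r).infinite_of_nontrivial ?_
      · rw [Complex.rank_real_complex]
        exact Nat.one_lt_ofNat
      · refine ⟨(r : ℂ), ?_, (-r : ℂ), ?_, ?_⟩
        · simp [abs_of_pos hr0]
        · simp [abs_of_pos hr0]
        · intro h
          have h' := congrArg Complex.re h
          simp at h'
          linarith
    exact hsph.sdiff hPfin
  refine ratFunc_eq_of_eval_eq_on_infinite hSinf (fun t ht h0 => ht.2 (Or.inl h0))
    (fun t ht h0 => ht.2 (Or.inr h0)) fun t ht => ?_
  have htr : ‖t‖ = r := by simpa using ht.1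
  have ht0 : t ≠ 0 := by
    intro h0
    rw [h0, norm_zero] at htr
    exact hr0.ne' htr.symm
  -- `t = q^{-s}` with `re s = c`
  set s : ℂ := -Complex.log t / (Real.log q : ℂ) with hs
  have hlogq0 : Real.log q ≠ 0 := Real.log_ne_zero_of_pos_of_ne_one hqpos hq1.ne'
  have hlogq : (Real.log q : ℂ) ≠ 0 := by exact_mod_cast hlogq0
  have hqc : (q : ℂ) ≠ 0 := by exact_mod_cast hqpos.ne'
  have hlogqc : Complex.log (q : ℂ) = (Real.log q : ℂ) := by
    rw [show ((q : ℕ) : ℂ) = ((q : ℝ) : ℂ) by push_cast; rfl, ← Complex.ofReal_log hqpos.le]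
  have hts : (q : ℂ) ^ (-s) = t := by
    rw [Complex.cpow_def_of_ne_zero hqc, hlogqc, hs, neg_div, neg_neg, ← mul_div_assoc,
      mul_div_cancel_left₀ _ hlogq, Complex.exp_log ht0]
  have hsre : s.re = c := by
    rw [hs, neg_div, Complex.neg_re, Complex.div_ofReal_re, Complex.log_re, htr, hr,
      Real.log_rpow hqpos]
    field_simp
  have h1 := h s (by rw [hsre, hc]; linarith) (by rw [hsre, hc]; linarith)
  simp only [evalAtQ, hts] at h1
  exact h1

variable {F : Type*} [Field F] [ValuativeRel F] [TopologicalSpace F] [IsNonarchimedeanLocalField F]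
  [MeasurableSpace F] [BorelSpace F]
  {ψ : AddChar F Circle} {μ : Measure F} {μ' : Measure Fˣ} {χ : QuasiChar F}

/-- **Uniqueness of Tate's `γ`-factor** (Tate 1950, Thm. 2.4.1; Bushnell–Henniart 2006, §23.4,
Theorem: `γ` is determined by the functional equation since some `Z(f, χ, s)` is not zero).
For `F` with its Borel structure and `μ'` a Haar measure on `Fˣ` — and for ANY `ψ`, `μ` — two
rational functions `γ, γ'` both satisfying `HasTateGamma ψ μ μ' χ ·` coincide: with an exponent
`σ` of `χ` (`QuasiChar.exists_hasExponent`) and the test function of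
`exists_schwartzBruhat_tateZeta_eq_const` (`Z(f, χ, s) = c ≠ 0`), the two functional equations
give `γ(q^{-s}) c = γ'(q^{-s}) c` on the strip `-σ < re s < 1 - σ`, whence `γ = γ'`
(`ratFunc_eq_of_evalAtQ_eq_on_strip`). [cite: Tate1950, Thm. 2.4.1] -/
theorem HasTateGamma.unique [μ'.IsHaarMeasure] {γ γ' : RatFunc ℂ} (h : HasTateGamma ψ μ μ' χ γ)
    (h' : HasTateGamma ψ μ μ' χ γ') : γ = γ' := by
  obtain ⟨σ, hσ⟩ := χ.exists_hasExponent
  obtain ⟨f, hf, c, hc, hZ⟩ := exists_schwartzBruhat_tateZeta_eq_const μ' χ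
  have hlt : -σ < 1 - σ := by linarith
  refine ratFunc_eq_of_evalAtQ_eq_on_strip (one_lt_residueFieldCard F) hlt fun s hs1 hs2 => ?_
  have e1 := h σ hσ f hf s hs1 hs2
  have e2 := h' σ hσ f hf s hs1 hs2
  rw [hZ s] at e1 e2
  exact mul_right_cancel₀ (Complex.ofReal_ne_zero.mpr hc.ne') (e1.symm.trans e2)

/-- Hence **`∃! γ` reduces to existence**: the uniqueness half of the named fact
`existsUnique_hasTateGamma` of `TateLocalFactors` (Tate 1950, Thm. 2.4.1) is proved.
[cite: Tate1950, Thm. 2.4.1] -/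
theorem HasTateGamma.existsUnique_of_exists [μ'.IsHaarMeasure]
    (h : ∃ γ : RatFunc ℂ, HasTateGamma ψ μ μ' χ γ) : ∃! γ : RatFunc ℂ, HasTateGamma ψ μ μ' χ γ := by
  obtain ⟨γ, hγ⟩ := h
  exact ⟨γ, hγ, fun γ' hγ' => hγ'.unique hγ⟩

end Uniqueness

/-! ### Unramified quasi-characters: the Euler factor and the conductor exponent `0` -/

section Unramified

variable {F : Type*} [Field F] [ValuativeRel F] [TopologicalSpace F] [IsNonarchimedeanLocalField F]

/-- An unramified quasi-character only sees the valuation: `χ(a) = χ(b)` whenever `v(a) = v(b)`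
(`a b⁻¹ ∈ 𝒪ˣ`; Tate 1950, §2.3). [cite: Tate1950, §2.3] -/
theorem QuasiChar.IsUnramified.apply_mk0_eq {χ : QuasiChar F} (h : χ.IsUnramified) {a b : F}
    (ha : a ≠ 0) (hb : b ≠ 0) (hab : valuation F a = valuation F b) :
    χ (Units.mk0 a ha) = χ (Units.mk0 b hb) := by
  have hvb : valuation F b ≠ 0 := by simpa using hb
  have hu : valuation F (((Units.mk0 a ha) * (Units.mk0 b hb)⁻¹ : Fˣ) : F) = 1 := by
    rw [Units.val_mul, Units.val_inv_eq_inv_val, Units.val_mk0, Units.val_mk0, map_mul, map_inv₀,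
      hab, mul_inv_cancel₀ hvb]
  have h1 := h _ (DeltaCharBorel.normAbs_eq_one_of_valuation_eq_one hu)
  rw [map_mul, map_inv, mul_inv_eq_one] at h1
  exact h1

/-- **Discharge of the named fact `tateEulerFactor_of_isUnramified`** (`TateLocalFactors`;
Tate 1950, §2.4: for unramified `χ`, `P_χ(T) = 1 - χ(ϖ) T` for ANY uniformiser `ϖ`): the
uniformiser hidden in `tateEulerFactor` (`Classical.arbitrary`) and the given one have the same
valuation, and an unramified `χ` only sees the valuation (`QuasiChar.IsUnramified.apply_mk0_eq`).
[cite: Tate1950, §2.4] -/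
theorem tateEulerFactor_of_isUnramified_holds : tateEulerFactor_of_isUnramified (F := F) := by
  intro χ h ϖ hϖ
  rw [tateEulerFactor, if_pos h]
  have hval : valuation F (((Classical.arbitrary ((valuation F).Uniformizer) : 𝒪[F]) : F)) =
      valuation F ϖ := by
    rw [(Classical.arbitrary ((valuation F).Uniformizer)).valuation_gt_one.val, hϖ.val]
  rw [h.apply_mk0_eq _ hϖ.ne_zero hval]

/-- `|x|_F = 1` implies `|x - 1|_F ≤ 1` (both `x` and `1` are integers). [folklore] -/
theorem normAbs_sub_one_le_one_of_normAbs_eq_one {x : F} (hx : normAbs F x = 1) :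
    normAbs F (x - 1) ≤ 1 := by
  rw [normAbs_le_one_iff]
  exact sub_mem (normAbs_le_one_iff.mp hx.le) (one_mem _)

/-- **Discharge of the named fact `QuasiChar.hasConductorExp_zero_iff`** (`TateLocalFactors`;
Tate 1950, §2.3; Bushnell–Henniart 2006, §1.8): `χ` has conductor exponent `0` iff it is
unramified — `U^0 = 𝒪ˣ = {|x| = 1}` (the extra condition `|x - 1| ≤ 1` of `unitFiltration F 0` is
automatic, `normAbs_sub_one_le_one_of_normAbs_eq_one`), and there is no `b < 0`.
[cite: Tate1950, §2.3] -/
theorem QuasiChar.hasConductorExp_zero_iff_holds :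
    QuasiChar.hasConductorExp_zero_iff (F := F) := by
  intro χ
  constructor
  · rintro ⟨h1, -⟩ x hx
    exact h1 x ⟨hx, by rw [pow_zero]; exact normAbs_sub_one_le_one_of_normAbs_eq_one hx⟩
  · intro h
    exact ⟨fun x hx => h x hx.1, fun b hb => absurd hb (Nat.not_lt_zero b)⟩

end Unramified

end Literature.NumberTheory.Automorphic
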